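import Summits.NavierStokesRegularity.NavierStokesRegularity.Theorems.OddMorawetzMorawetzKillsTypeIJetCoordDefs
import Summits.NavierStokesRegularity.NavierStokesRegularity.Theorems.OddMorawetzMorawetzKillsTypeISignedPermBasis

/-!
# Crux `OddMorawetz.MorawetzKillsTypeI` — stub `stub_kitPerm` (the index-relabelling rule)

Item `stmt-NavierStokesRegularity-1377`, line `registered`.  For a continuous trilinear form `T` on 3-jets
which is invariant under the simultaneous jet action of every linear isometry of `ℝ³`
(`T (g·x₁, g·x₂, g·x₃) = T (x₁, x₂, x₃)`), relabelling ALL indices of a coefficient `T (X, Y, W)` on pure basis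
jets — `(e_a, 0, 0, 0)` and `(0, …, jbsum n c J, …)` — by a permutation `σ ∈ 𝔖₃` does not change the
coefficient.  The six registered blocks are `u u T`, `u A H`, `A A A` (weight 3) and `u H T`, `A A T`, `A H H`
(weight 5).

Proof: take `g := signedPerm σ 1`, the pure coordinate permutation (all signs `+1`).  By the landed
`signedPerm_single`, `g e_a = e_{σ a}`; by the landed `mlAct_signedPerm_basis` (summed over the orderings
`π ∈ 𝔖ₙ` of `jbsum`), `mlAct g n (jbsum n c J) = jbsum n (σ c) (σ ∘ J)`.  Hence the jet action of `g` maps each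
pure basis jet to the relabelled one (`jetAct_apply`), and invariance of `T` under `g` is the claim.
-/

noncomputable section

set_option linter.dupNamespace false

namespace Summit.NavierStokesRegularity.NavierStokesRegularity.Theorems

open Summit.NavierStokesRegularity.NavierStokesRegularity.Theorems.OddMorawetz

namespace KitPerm

/-! ### The coordinate permutation `signedPerm σ 1` on basis vectors and basis multilinear maps -/

/-- The pure coordinate permutation maps `e_i` to `e_{σ i}`. -/
theorem signedPerm_one_single (σ : Equiv.Perm (Fin 3)) (i : Fin 3) :
    signedPerm σ 1 (EuclideanSpace.single i (1 : ℝ)) = EuclideanSpace.single (σ i) (1 : ℝ) := by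
  rw [signedPerm_single]
  simp

/-- The pure coordinate permutation maps the basis multilinear map `jbasis n c J` to
`jbasis n (σ c) (σ ∘ J)`. -/
theorem mlAct_perm_jbasis (σ : Equiv.Perm (Fin 3)) (n : ℕ) (c : Fin 3) (J : Fin n → Fin 3) :
    mlAct (signedPerm σ 1) n (jbasis n c J) = jbasis n (σ c) (σ ∘ J) := by
  have h := mlAct_signedPerm_basis σ 1 n c J
  simp only [Pi.one_apply, Units.val_one, Int.cast_one, Finset.prod_const_one, mul_one, one_smul] at h
  exact h

/-- The pure coordinate permutation maps the symmetrised basis map `jbsum n c J` to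
`jbsum n (σ c) (σ ∘ J)`. -/
theorem mlAct_perm_jbsum (σ : Equiv.Perm (Fin 3)) (n : ℕ) (c : Fin 3) (J : Fin n → Fin 3) :
    mlAct (signedPerm σ 1) n (jbsum n c J) = jbsum n (σ c) (σ ∘ J) := by
  simp only [jbsum_def, map_sum, mlAct_perm_jbasis]
  rfl

/-! ### The jet action on pure jets -/

/-- Jet action on a pure order-`0` jet. -/
theorem jetAct_pure₀ (g : E3 ≃ₗᵢ[ℝ] E3) (v : E3) :
    jetAct g ((v, 0, 0, 0) : Jet3) = ((g v, 0, 0, 0) : Jet3) := by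
  simp [jetAct_apply]

/-- Jet action on a pure order-`1` jet. -/
theorem jetAct_pure₁ (g : E3 ≃ₗᵢ[ℝ] E3) (X : E3 [×1]→L[ℝ] E3) :
    jetAct g ((0, X, 0, 0) : Jet3) = ((0, mlAct g 1 X, 0, 0) : Jet3) := by
  simp [jetAct_apply]

/-- Jet action on a pure order-`2` jet. -/
theorem jetAct_pure₂ (g : E3 ≃ₗᵢ[ℝ] E3) (X : E3 [×2]→L[ℝ] E3) :
    jetAct g ((0, 0, X, 0) : Jet3) = ((0, 0, mlAct g 2 X, 0) : Jet3) := by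
  simp [jetAct_apply]

/-- Jet action on a pure order-`3` jet. -/
theorem jetAct_pure₃ (g : E3 ≃ₗᵢ[ℝ] E3) (X : E3 [×3]→L[ℝ] E3) :
    jetAct g ((0, 0, 0, X) : Jet3) = ((0, 0, 0, mlAct g 3 X) : Jet3) := by
  simp [jetAct_apply]

/-- The coordinate permutation on the pure basis jet `(e_a, 0, 0, 0)`. -/
theorem jetAct_perm_U (σ : Equiv.Perm (Fin 3)) (a : Fin 3) :
    jetAct (signedPerm σ 1) ((EuclideanSpace.single a (1 : ℝ), 0, 0, 0) : Jet3) =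
      ((EuclideanSpace.single (σ a) (1 : ℝ), 0, 0, 0) : Jet3) := by
  rw [jetAct_pure₀, signedPerm_one_single]

/-- The coordinate permutation on the pure basis jet `(0, jbsum 1 c J, 0, 0)`. -/
theorem jetAct_perm_A (σ : Equiv.Perm (Fin 3)) (c : Fin 3) (J : Fin 1 → Fin 3) :
    jetAct (signedPerm σ 1) ((0, jbsum 1 c J, 0, 0) : Jet3) = ((0, jbsum 1 (σ c) (σ ∘ J), 0, 0) : Jet3) := by
  rw [jetAct_pure₁, mlAct_perm_jbsum]

/-- The coordinate permutation on the pure basis jet `(0, 0, jbsum 2 c J, 0)`. -/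
theorem jetAct_perm_H (σ : Equiv.Perm (Fin 3)) (c : Fin 3) (J : Fin 2 → Fin 3) :
    jetAct (signedPerm σ 1) ((0, 0, jbsum 2 c J, 0) : Jet3) = ((0, 0, jbsum 2 (σ c) (σ ∘ J), 0) : Jet3) := by
  rw [jetAct_pure₂, mlAct_perm_jbsum]

/-- The coordinate permutation on the pure basis jet `(0, 0, 0, jbsum 3 c J)`. -/
theorem jetAct_perm_T (σ : Equiv.Perm (Fin 3)) (c : Fin 3) (J : Fin 3 → Fin 3) :
    jetAct (signedPerm σ 1) ((0, 0, 0, jbsum 3 c J) : Jet3) = ((0, 0, 0, jbsum 3 (σ c) (σ ∘ J)) : Jet3) := by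
  rw [jetAct_pure₃, mlAct_perm_jbsum]

/-! ### Invariance of `T` in `![…]` form and the six blocks -/

section Invariant

variable {T : Jet3 [×3]→L[ℝ] ℝ}
  (hT : ∀ (g : E3 ≃ₗᵢ[ℝ] E3) (x : Fin 3 → Jet3), T (fun s => jetAct g (x s)) = T x)
include hT

/-- Invariance of `T` under the simultaneous jet action, in `![P₁, P₂, P₃]` form. -/
theorem tri_jetAct (g : E3 ≃ₗᵢ[ℝ] E3) (P₁ P₂ P₃ : Jet3) :
    T ![jetAct g P₁, jetAct g P₂, jetAct g P₃] = T ![P₁, P₂, P₃] := by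
  have h : (fun s => jetAct g (![P₁, P₂, P₃] s)) = ![jetAct g P₁, jetAct g P₂, jetAct g P₃] := by
    funext s
    fin_cases s <;> rfl
  rw [← h]
  exact hT g _

/-- Block `u u T`. -/
theorem perm_uuT (σ : Equiv.Perm (Fin 3)) (a a' c : Fin 3) (J : Fin 3 → Fin 3) :
    T ![((EuclideanSpace.single (σ a) (1 : ℝ), 0, 0, 0) : Jet3),
        ((EuclideanSpace.single (σ a') (1 : ℝ), 0, 0, 0) : Jet3), ((0, 0, 0, jbsum 3 (σ c) (σ ∘ J)) : Jet3)] =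
      T ![((EuclideanSpace.single a (1 : ℝ), 0, 0, 0) : Jet3),
        ((EuclideanSpace.single a' (1 : ℝ), 0, 0, 0) : Jet3), ((0, 0, 0, jbsum 3 c J) : Jet3)] := by
  rw [← jetAct_perm_U σ a, ← jetAct_perm_U σ a', ← jetAct_perm_T σ c J]
  exact tri_jetAct hT _ _ _ _

/-- Block `u A H`. -/
theorem perm_uAH (σ : Equiv.Perm (Fin 3)) (a c₁ : Fin 3) (J₁ : Fin 1 → Fin 3) (c₂ : Fin 3)
    (J₂ : Fin 2 → Fin 3) :
    T ![((EuclideanSpace.single (σ a) (1 : ℝ), 0, 0, 0) : Jet3), ((0, jbsum 1 (σ c₁) (σ ∘ J₁), 0, 0) : Jet3),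
        ((0, 0, jbsum 2 (σ c₂) (σ ∘ J₂), 0) : Jet3)] =
      T ![((EuclideanSpace.single a (1 : ℝ), 0, 0, 0) : Jet3), ((0, jbsum 1 c₁ J₁, 0, 0) : Jet3),
        ((0, 0, jbsum 2 c₂ J₂, 0) : Jet3)] := by
  rw [← jetAct_perm_U σ a, ← jetAct_perm_A σ c₁ J₁, ← jetAct_perm_H σ c₂ J₂]
  exact tri_jetAct hT _ _ _ _

/-- Block `A A A`. -/
theorem perm_AAA (σ : Equiv.Perm (Fin 3)) (c₁ : Fin 3) (J₁ : Fin 1 → Fin 3) (c₂ : Fin 3) (J₂ : Fin 1 → Fin 3)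
    (c₃ : Fin 3) (J₃ : Fin 1 → Fin 3) :
    T ![((0, jbsum 1 (σ c₁) (σ ∘ J₁), 0, 0) : Jet3), ((0, jbsum 1 (σ c₂) (σ ∘ J₂), 0, 0) : Jet3),
        ((0, jbsum 1 (σ c₃) (σ ∘ J₃), 0, 0) : Jet3)] =
      T ![((0, jbsum 1 c₁ J₁, 0, 0) : Jet3), ((0, jbsum 1 c₂ J₂, 0, 0) : Jet3), ((0, jbsum 1 c₃ J₃, 0, 0) : Jet3)] := by
  rw [← jetAct_perm_A σ c₁ J₁, ← jetAct_perm_A σ c₂ J₂, ← jetAct_perm_A σ c₃ J₃]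
  exact tri_jetAct hT _ _ _ _

/-- Block `u H T`. -/
theorem perm_uHT (σ : Equiv.Perm (Fin 3)) (a c₂ : Fin 3) (J₂ : Fin 2 → Fin 3) (c₃ : Fin 3) (J₃ : Fin 3 → Fin 3) :
    T ![((EuclideanSpace.single (σ a) (1 : ℝ), 0, 0, 0) : Jet3), ((0, 0, jbsum 2 (σ c₂) (σ ∘ J₂), 0) : Jet3),
        ((0, 0, 0, jbsum 3 (σ c₃) (σ ∘ J₃)) : Jet3)] =
      T ![((EuclideanSpace.single a (1 : ℝ), 0, 0, 0) : Jet3), ((0, 0, jbsum 2 c₂ J₂, 0) : Jet3),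
        ((0, 0, 0, jbsum 3 c₃ J₃) : Jet3)] := by
  rw [← jetAct_perm_U σ a, ← jetAct_perm_H σ c₂ J₂, ← jetAct_perm_T σ c₃ J₃]
  exact tri_jetAct hT _ _ _ _

/-- Block `A A T`. -/
theorem perm_AAT (σ : Equiv.Perm (Fin 3)) (c₁ : Fin 3) (J₁ : Fin 1 → Fin 3) (c₂ : Fin 3) (J₂ : Fin 1 → Fin 3)
    (c₃ : Fin 3) (J₃ : Fin 3 → Fin 3) :
    T ![((0, jbsum 1 (σ c₁) (σ ∘ J₁), 0, 0) : Jet3), ((0, jbsum 1 (σ c₂) (σ ∘ J₂), 0, 0) : Jet3),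
        ((0, 0, 0, jbsum 3 (σ c₃) (σ ∘ J₃)) : Jet3)] =
      T ![((0, jbsum 1 c₁ J₁, 0, 0) : Jet3), ((0, jbsum 1 c₂ J₂, 0, 0) : Jet3), ((0, 0, 0, jbsum 3 c₃ J₃) : Jet3)] := by
  rw [← jetAct_perm_A σ c₁ J₁, ← jetAct_perm_A σ c₂ J₂, ← jetAct_perm_T σ c₃ J₃]
  exact tri_jetAct hT _ _ _ _

/-- Block `A H H`. -/
theorem perm_AHH (σ : Equiv.Perm (Fin 3)) (c₁ : Fin 3) (J₁ : Fin 1 → Fin 3) (c₂ : Fin 3) (J₂ : Fin 2 → Fin 3)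
    (c₃ : Fin 3) (J₃ : Fin 2 → Fin 3) :
    T ![((0, jbsum 1 (σ c₁) (σ ∘ J₁), 0, 0) : Jet3), ((0, 0, jbsum 2 (σ c₂) (σ ∘ J₂), 0) : Jet3),
        ((0, 0, jbsum 2 (σ c₃) (σ ∘ J₃), 0) : Jet3)] =
      T ![((0, jbsum 1 c₁ J₁, 0, 0) : Jet3), ((0, 0, jbsum 2 c₂ J₂, 0) : Jet3), ((0, 0, jbsum 2 c₃ J₃, 0) : Jet3)] := by
  rw [← jetAct_perm_A σ c₁ J₁, ← jetAct_perm_H σ c₂ J₂, ← jetAct_perm_H σ c₃ J₃]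
  exact tri_jetAct hT _ _ _ _

end Invariant

end KitPerm

/-! ### The registered statement -/

/-- **stub `stub_kitPerm` of the crux `OddMorawetz.MorawetzKillsTypeI` (line `registered`): the
index-RELABELLING rule.** For an isometry-invariant trilinear form `T` on 3-jets, relabelling all indices of a
coefficient `T (X, Y, W)` on pure basis jets by a permutation `σ ∈ 𝔖₃` (the coordinate permutation isometry
`signedPerm σ 1`) does not change it: blocks `u u T`, `u A H`, `A A A` (weight 3) and `u H T`, `A A T`, `A H H`
(weight 5). -/
theorem stub_kitPerm :
    let e : Fin 3 → E3 := fun i => EuclideanSpace.single i (1 : ℝ);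
    ∀ (T : Jet3 [×3]→L[ℝ] ℝ),
      (∀ (g : E3 ≃ₗᵢ[ℝ] E3) (x : Fin 3 → Jet3), T (fun s => jetAct g (x s)) = T x) →
      (∀ (σ : Equiv.Perm (Fin 3)) (a a' c : Fin 3) (J : Fin 3 → Fin 3),
        T ![((e (σ a), 0, 0, 0) : Jet3), ((e (σ a'), 0, 0, 0) : Jet3), ((0, 0, 0, jbsum 3 (σ c) (σ ∘ J)) : Jet3)] =
          T ![((e a, 0, 0, 0) : Jet3), ((e a', 0, 0, 0) : Jet3), ((0, 0, 0, jbsum 3 c J) : Jet3)]) ∧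
      (∀ (σ : Equiv.Perm (Fin 3)) (a c₁ : Fin 3) (J₁ : Fin 1 → Fin 3) (c₂ : Fin 3) (J₂ : Fin 2 → Fin 3),
        T ![((e (σ a), 0, 0, 0) : Jet3), ((0, jbsum 1 (σ c₁) (σ ∘ J₁), 0, 0) : Jet3), ((0, 0, jbsum 2 (σ c₂) (σ ∘ J₂), 0) : Jet3)] =
          T ![((e a, 0, 0, 0) : Jet3), ((0, jbsum 1 c₁ J₁, 0, 0) : Jet3), ((0, 0, jbsum 2 c₂ J₂, 0) : Jet3)]) ∧
      (∀ (σ : Equiv.Perm (Fin 3)) (c₁ : Fin 3) (J₁ : Fin 1 → Fin 3) (c₂ : Fin 3) (J₂ : Fin 1 → Fin 3) (c₃ : Fin 3) (J₃ : Fin 1 → Fin 3),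
        T ![((0, jbsum 1 (σ c₁) (σ ∘ J₁), 0, 0) : Jet3), ((0, jbsum 1 (σ c₂) (σ ∘ J₂), 0, 0) : Jet3), ((0, jbsum 1 (σ c₃) (σ ∘ J₃), 0, 0) : Jet3)] =
          T ![((0, jbsum 1 c₁ J₁, 0, 0) : Jet3), ((0, jbsum 1 c₂ J₂, 0, 0) : Jet3), ((0, jbsum 1 c₃ J₃, 0, 0) : Jet3)]) ∧
      (∀ (σ : Equiv.Perm (Fin 3)) (a c₂ : Fin 3) (J₂ : Fin 2 → Fin 3) (c₃ : Fin 3) (J₃ : Fin 3 → Fin 3),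
        T ![((e (σ a), 0, 0, 0) : Jet3), ((0, 0, jbsum 2 (σ c₂) (σ ∘ J₂), 0) : Jet3), ((0, 0, 0, jbsum 3 (σ c₃) (σ ∘ J₃)) : Jet3)] =
          T ![((e a, 0, 0, 0) : Jet3), ((0, 0, jbsum 2 c₂ J₂, 0) : Jet3), ((0, 0, 0, jbsum 3 c₃ J₃) : Jet3)]) ∧
      (∀ (σ : Equiv.Perm (Fin 3)) (c₁ : Fin 3) (J₁ : Fin 1 → Fin 3) (c₂ : Fin 3) (J₂ : Fin 1 → Fin 3) (c₃ : Fin 3) (J₃ : Fin 3 → Fin 3),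
        T ![((0, jbsum 1 (σ c₁) (σ ∘ J₁), 0, 0) : Jet3), ((0, jbsum 1 (σ c₂) (σ ∘ J₂), 0, 0) : Jet3), ((0, 0, 0, jbsum 3 (σ c₃) (σ ∘ J₃)) : Jet3)] =
          T ![((0, jbsum 1 c₁ J₁, 0, 0) : Jet3), ((0, jbsum 1 c₂ J₂, 0, 0) : Jet3), ((0, 0, 0, jbsum 3 c₃ J₃) : Jet3)]) ∧
      (∀ (σ : Equiv.Perm (Fin 3)) (c₁ : Fin 3) (J₁ : Fin 1 → Fin 3) (c₂ : Fin 3) (J₂ : Fin 2 → Fin 3) (c₃ : Fin 3) (J₃ : Fin 2 → Fin 3),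
        T ![((0, jbsum 1 (σ c₁) (σ ∘ J₁), 0, 0) : Jet3), ((0, 0, jbsum 2 (σ c₂) (σ ∘ J₂), 0) : Jet3), ((0, 0, jbsum 2 (σ c₃) (σ ∘ J₃), 0) : Jet3)] =
          T ![((0, jbsum 1 c₁ J₁, 0, 0) : Jet3), ((0, 0, jbsum 2 c₂ J₂, 0) : Jet3), ((0, 0, jbsum 2 c₃ J₃, 0) : Jet3)]) := by
  intro _ T hT
  exact ⟨KitPerm.perm_uuT hT, KitPerm.perm_uAH hT, KitPerm.perm_AAA hT, KitPerm.perm_uHT hT,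
    KitPerm.perm_AAT hT, KitPerm.perm_AHH hT⟩

end Summit.NavierStokesRegularity.NavierStokesRegularity.Theorems

end
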